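import Mathlib
import HarnessLib

/-!
# Quadratic twists `K(i√p)` of a subfield `K ⊂ ℂ`: elements, the intersection of two twists, and a prime square root
# missing from any number field

Topic `NumberTheory/NumberFields`; namespace `Literature.NumberTheory.NumberFields`.  ONE definition (`twistRoot p = i√p ∈ ℂ`, the
distinguished complex square root of `-p`) and theorems; no named fact, no instance, no notation.  Cell hodgecm-mathlib, binder `hDel`
(crux `HDel` = stmt-HodgeConjecture-24835), cut of record v12 «K-TWIST» (A-p05 g3 2026-08-28T05:27:30Z, director g2 05:35:20Z), piece
P2 (c)(d): the FIELD SUPPLY of the twist — the closing step `Summit.HodgeConjecture.CorCM.HypDel.isCanonicalDescentAt_of_ext_of_twistFields`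
needs two composita `E₁ = τ(L)(i√p)`, `E₂ = τ(L)(i√q)` meeting inside `τ(L)` ([Deligne1979ShimuraVarieties] 2.3.10 (i): the reflex field
of the twisted datum is `E(G,X)·E(K,h_T) ⊆ τ(L)(i√p)`; [Deligne1971TravauxShimura] Prop. 5.10 then descends to the intersection).
HC_CM is proved only modulo the 7 printed citations until rung 0 closes; nothing here discharges a binder.

## What is proved (elementary field theory inside `ℂ`)

* §1 `twistRoot p := i·√p`: `twistRoot_mul_self` (`= -p`), real/imaginary parts, `twistRoot_mul_self_mem`.
* §2 `exists_add_mul_of_mem_sup_adjoin`: for a subfield `K ⊆ ℂ` and `r ∈ ℂ` with `r² ∈ K`, every element of `K ⊔ ℚ(r) = K⟮r⟯` is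
  `a + b·r` with `a, b ∈ K` (Mathlib `restrictScalars_adjoin_eq_sup` + the power basis of `K⟮r⟯`, `deg minpoly_K(r) ≤ 2`).
* §3 `inf_sup_adjoin_subset`: if moreover `r₂ ∉ K(r₁)` (and `r₂² ∈ K`) then `K(r₁) ∩ K(r₂) ⊆ K`; read at `K = τ(L)`, `rᵢ = i√pᵢ`:
  `subset_range_of_twistRoot_not_mem`.
* §4 `exists_prime_twistRoot_not_mem`: every number field `E ⊆ ℂ` omits `i√q` for some prime `q` (a finite separable extension has
  finitely many intermediate fields — Mathlib `Field.finite_intermediateField_of_exists_primitive_element` — while `q ↦ ℚ(i√q) ⊆ E` is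
  injective on primes: `i√q' = a + b·i√q` with `a, b ∈ ℚ` forces `a = 0`, `√q' = b√q`, `qq'` a square, `q = q'`).

## References
* [Deligne1979ShimuraVarieties] P. Deligne, *Variétés de Shimura*, PSPM 33.2 (1979), 2.3.10 (i) (Milne's transl. p. 32).
* [Deligne1971TravauxShimura] P. Deligne, *Travaux de Shimura*, Sém. Bourbaki 389 (1971), Prop. 5.10 (p. 157).
* [Lang2002] S. Lang, *Algebra* (3rd ed.), Ch. V §1 Prop. 1.4 (simple algebraic extensions), Ch. V §4 (primitive element).
-/

set_option autoImplicit false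

noncomputable section

open IntermediateField Polynomial

namespace Literature.NumberTheory.NumberFields

/-! ### §1. The distinguished square root `i√p` of `-p` -/

/-- `twistRoot p = i·√p ∈ ℂ`, the square root of `-p` in the upper half plane. [folklore] -/
def twistRoot (p : ℕ) : ℂ := Complex.I * (Real.sqrt p : ℂ)

/-- `(i√p)² = -p` — `i√p` generates the imaginary quadratic field `ℚ(√-p)` of Deligne's auxiliary extension `K = F(√-p)`.
[cite: Deligne1979ShimuraVarieties, 2.3.9 (PDF p. 32 of Milne's translation)] [cite: Lang2002, Ch. V §1 Example 1] -/
theorem twistRoot_mul_self (p : ℕ) : twistRoot p * twistRoot p = -(p : ℂ) := by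
  unfold twistRoot
  have h : ((Real.sqrt p : ℝ) : ℂ) * ((Real.sqrt p : ℝ) : ℂ) = (p : ℂ) := by
    rw [← Complex.ofReal_mul, Real.mul_self_sqrt (Nat.cast_nonneg p)]
    simp
  calc Complex.I * (Real.sqrt p : ℂ) * (Complex.I * (Real.sqrt p : ℂ))
      = (Complex.I * Complex.I) * (((Real.sqrt p : ℝ) : ℂ) * ((Real.sqrt p : ℝ) : ℂ)) := by ring
    _ = -(p : ℂ) := by rw [Complex.I_mul_I, h]; ring

/-- `Re(i√p) = 0`. [folklore] -/
@[simp] private theorem twistRoot_re (p : ℕ) : (twistRoot p).re = 0 := by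
  simp [twistRoot]

/-- `Im(i√p) = √p`. [folklore] -/
@[simp] private theorem twistRoot_im (p : ℕ) : (twistRoot p).im = Real.sqrt p := by
  simp [twistRoot]

/-- `(i√p)² ∈ K` for every subfield `K ⊆ ℂ` (it is the rational `-p`). [cite: Lang2002, Ch. V §1 Example 1] -/
theorem twistRoot_mul_self_mem (p : ℕ) (K : IntermediateField ℚ ℂ) : twistRoot p * twistRoot p ∈ K := by
  rw [twistRoot_mul_self]
  exact neg_mem (IntermediateField.natCast_mem K p)

/-! ### §2. Elements of `K(r)` for `r² ∈ K` -/

section General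

variable {Ω : Type*} [Field Ω] [CharZero Ω]

/-- **`K(r) = K + K·r` when `r² ∈ K`**: for a subfield `K` of a field `Ω ⊇ ℚ` and `r ∈ Ω` with `r² ∈ K`, every element of the
compositum `K ⊔ ℚ(r) = K⟮r⟯` is `a + b·r` with `a, b ∈ K` (the power basis of `K⟮r⟯` has `deg minpoly_K(r) ≤ 2` elements since `r`
is a root of `X² - r² ∈ K[X]`). [cite: Lang2002, Ch. V §1 Prop. 1.4] -/
theorem exists_add_mul_of_mem_sup_adjoin (K : IntermediateField ℚ Ω) {r : Ω} (hr : r * r ∈ K) {z : Ω}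
    (hz : z ∈ K ⊔ IntermediateField.adjoin ℚ {r}) : ∃ a ∈ K, ∃ b ∈ K, z = a + b * r := by
  -- `z ∈ A := K⟮r⟯` (adjoin over the field `K`): `K ⊔ ℚ⟮r⟯ ≤ A` as subfields of `Ω`
  set A : IntermediateField (↥K) Ω := IntermediateField.adjoin (↥K) ({r} : Set Ω) with hA
  let A' : IntermediateField ℚ Ω := A.toSubfield.toIntermediateField fun x => by
    rw [eq_ratCast]
    exact SubfieldClass.ratCast_mem A.toSubfield x
  have hle : K ⊔ IntermediateField.adjoin ℚ {r} ≤ A' := by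
    refine sup_le (fun x hx => ?_) (IntermediateField.adjoin_le_iff.2 (Set.singleton_subset_iff.2 ?_))
    · change x ∈ A
      exact A.algebraMap_mem ⟨x, hx⟩
    · change r ∈ A
      exact IntermediateField.mem_adjoin_simple_self (↥K) r
  have hz' : z ∈ A := hle hz
  -- `r` is integral over `K`, with minimal polynomial of degree `≤ 2`
  have hmon : (X ^ 2 - C (⟨r * r, hr⟩ : ↥K) : (↥K)[X]).Monic :=
    (monic_X_pow 2).sub_of_left (degree_C_le.trans_lt (by simp))
  have hroot : aeval r (X ^ 2 - C (⟨r * r, hr⟩ : ↥K) : (↥K)[X]) = 0 := by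
    simp [sq]
  have hint : IsIntegral (↥K) r := ⟨_, hmon, by simpa [aeval_def] using hroot⟩
  have hdeg : (minpoly (↥K) r).natDegree ≤ 2 := by
    calc (minpoly (↥K) r).natDegree ≤ (X ^ 2 - C (⟨r * r, hr⟩ : ↥K) : (↥K)[X]).natDegree :=
          natDegree_le_of_dvd (minpoly.dvd _ _ hroot) hmon.ne_zero
      _ ≤ 2 := by
          rw [natDegree_sub_C, natDegree_X_pow]
  -- expand `z` on the power basis `1, r`
  let pb := IntermediateField.adjoin.powerBasis hint
  obtain ⟨f, hf, hzf⟩ := pb.exists_eq_aeval ⟨z, hz'⟩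
  have hdim : pb.dim = (minpoly (↥K) r).natDegree := IntermediateField.adjoin.powerBasis_dim hint
  have hf1 : f.natDegree ≤ 1 := by omega
  have hgen : ((pb.gen : ↥(IntermediateField.adjoin (↥K) ({r} : Set Ω))) : Ω) = r := by
    rw [IntermediateField.adjoin.powerBasis_gen]; rfl
  have h0 : ∀ x : ↥K, (((algebraMap ↥K ↥(IntermediateField.adjoin (↥K) ({r} : Set Ω))) x :
      ↥(IntermediateField.adjoin (↥K) ({r} : Set Ω))) : Ω) = (x : Ω) := fun x => rfl
  refine ⟨f.coeff 0, (f.coeff 0).2, f.coeff 1, (f.coeff 1).2, ?_⟩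
  have key := congrArg (fun w : ↥(IntermediateField.adjoin (↥K) ({r} : Set Ω)) => (w : Ω)) hzf
  simp only at key
  rw [eq_X_add_C_of_natDegree_le_one hf1] at key
  rw [key]
  simp only [map_add, map_mul, aeval_C, aeval_X]
  push_cast
  rw [hgen, h0, h0, add_comm]

/-! ### §3. The intersection of two twists -/

/-- **`K(r₁) ∩ K(r₂) ⊆ K` when `r₂² ∈ K` and `r₂ ∉ K(r₁)`**: an element `z = a + b·r₂` (`a, b ∈ K`) of `K(r₂)` lying in `K(r₁)` has
`b = 0` (else `r₂ = b⁻¹(z - a) ∈ K(r₁)`), so `z = a ∈ K`. [cite: Lang2002, Ch. V §1 Prop. 1.4] -/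
theorem inf_sup_adjoin_subset (K : IntermediateField ℚ Ω) {r₁ r₂ : Ω} (h₂ : r₂ * r₂ ∈ K)
    (hr : r₂ ∉ K ⊔ IntermediateField.adjoin ℚ {r₁}) :
    (((K ⊔ IntermediateField.adjoin ℚ {r₁}) ⊓ (K ⊔ IntermediateField.adjoin ℚ {r₂}) : IntermediateField ℚ Ω) : Set Ω) ⊆ K := by
  intro z hz
  obtain ⟨hz₁, hz₂⟩ := (IntermediateField.mem_inf.1 hz : _ ∧ _)
  obtain ⟨a, ha, b, hb, rfl⟩ := exists_add_mul_of_mem_sup_adjoin K h₂ hz₂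
  by_cases hb0 : b = 0
  · rw [hb0, zero_mul, add_zero]
    exact ha
  · exfalso
    apply hr
    have haE : a ∈ K ⊔ IntermediateField.adjoin ℚ {r₁} := (le_sup_left : K ≤ _) ha
    have hbE : b ∈ K ⊔ IntermediateField.adjoin ℚ {r₁} := (le_sup_left : K ≤ _) hb
    have : r₂ = b⁻¹ * (a + b * r₂ - a) := by rw [add_sub_cancel_left, inv_mul_cancel_left₀ hb0]
    rw [this]
    exact mul_mem (inv_mem hbE) (sub_mem hz₁ haE)

end General

/-- **Read at `K = τ(L) ⊆ ℂ`, `rᵢ = i√pᵢ`**: if `i√q ∉ τ(L)(i√p)` then `τ(L)(i√p) ∩ τ(L)(i√q) ⊆ τ(L)` — the census inclusion `hcap` of the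
K-twist closing step (`Summit.HodgeConjecture.CorCM.HypDel.isCanonicalDescentAt_of_ext_of_twistFields`). [cite: Deligne1979ShimuraVarieties, 2.3.10 (i)]
[cite: Deligne1971TravauxShimura, Prop. 5.10 p. 157] -/
theorem subset_range_of_twistRoot_not_mem {L : Type*} [Field L] [Algebra ℚ L] (τ : L →ₐ[ℚ] ℂ) {p q : ℕ}
    (hq : twistRoot q ∉ τ.fieldRange ⊔ IntermediateField.adjoin ℚ {twistRoot p}) :
    (((τ.fieldRange ⊔ IntermediateField.adjoin ℚ {twistRoot p}) ⊓ (τ.fieldRange ⊔ IntermediateField.adjoin ℚ {twistRoot q}) :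
        IntermediateField ℚ ℂ) : Set ℂ) ⊆ Set.range τ := by
  intro z hz
  have hz' := inf_sup_adjoin_subset τ.fieldRange (twistRoot_mul_self_mem q τ.fieldRange) hq hz
  obtain ⟨x, hx⟩ := AlgHom.mem_fieldRange.1 hz'
  exact ⟨x, hx⟩

/-! ### §4. A prime square root missing from a number field -/

/-- `i√q' = a + b·i√q` with `a, b ∈ ℚ` and `q, q'` prime forces `q = q'`: imaginary parts give `√q' = b√q`, so `q·q' = (bq)²` is the
square of a rational, hence of a natural number, and `q ∣ q'`. [cite: Lang2002, Ch. VI §1 Example 1] -/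
theorem eq_of_twistRoot_eq_add_mul {q q' : ℕ} (hq : q.Prime) (hq' : q'.Prime) {a b : ℚ}
    (hab : twistRoot q' = (a : ℂ) + (b : ℂ) * twistRoot q) : q = q' := by
  -- imaginary parts: `√q' = b·√q`
  have him := congrArg Complex.im hab
  simp only [Complex.add_im, Complex.mul_im, Complex.ratCast_re, Complex.ratCast_im, twistRoot_re, twistRoot_im,
    mul_zero, add_zero, zero_add] at him
  -- square: `q' = b² q` in `ℝ`, then in `ℚ`
  have hsqR : (q' : ℝ) = (b : ℝ) ^ 2 * q := by
    have := congrArg (fun t : ℝ => t ^ 2) him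
    simpa only [mul_pow, Real.sq_sqrt (Nat.cast_nonneg _)] using this
  have hsqQ : ((q * q' : ℕ) : ℚ) = (b * q) ^ 2 := by
    have h1 : (q' : ℚ) = b ^ 2 * q := by exact_mod_cast hsqR
    push_cast
    rw [h1]
    ring
  -- hence `q * q'` is a perfect square of naturals
  have hnat : IsSquare (q * q') := by
    have h1 : IsSquare ((q * q' : ℕ) : ℚ) := ⟨b * q, by rw [hsqQ, sq]⟩
    exact Rat.isSquare_natCast_iff.1 h1
  obtain ⟨s, hs⟩ := hnat
  -- `q ∣ s`, so `q ∣ q'`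
  have hqs : q ∣ s := by
    have : q ∣ s * s := ⟨q', hs.symm⟩
    exact ((Nat.Prime.dvd_mul hq).1 this).elim id id
  obtain ⟨t, rfl⟩ := hqs
  have hqq' : q ∣ q' := by
    have h2 : q * q' = q * (q * t * t) := by rw [hs]; ring
    have h3 : q' = q * t * t := Nat.eq_of_mul_eq_mul_left hq.pos h2
    exact ⟨t * t, by rw [h3]; ring⟩
  exact (Nat.prime_dvd_prime_iff_eq hq hq').1 hqq'

/-- **Every number field `E ⊆ ℂ` omits `i√q` for some prime `q`**: `E/ℚ` has finitely many intermediate fields (primitive element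
theorem), while for distinct primes the subfields `ℚ(i√q) ⊆ E` are distinct (`eq_of_twistRoot_eq_add_mul` with §2 inside `E`).
[cite: Lang2002, Ch. V §4 Thm. 4.6] [cite: Deligne1979ShimuraVarieties, 2.3.10 (i)] -/
theorem exists_prime_twistRoot_not_mem (E : IntermediateField ℚ ℂ) [FiniteDimensional ℚ ↥E] :
    ∃ q : ℕ, q.Prime ∧ twistRoot q ∉ E := by
  by_contra hall
  push Not at hall
  -- the square roots as elements of `E`
  let w : ℕ → ↥E := fun q => if h : q.Prime then ⟨twistRoot q, hall q h⟩ else 0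
  have hw : ∀ q : ℕ, q.Prime → ((w q : ↥E) : ℂ) = twistRoot q := fun q h => by
    simp only [w, dif_pos h]
  -- finitely many intermediate fields of `E/ℚ`, infinitely many primes
  haveI : Finite (IntermediateField ℚ ↥E) :=
    Field.finite_intermediateField_of_exists_primitive_element ℚ ↥E (Field.exists_primitive_element ℚ ↥E)
  haveI : Infinite {q : ℕ // q.Prime} := Nat.infinite_setOf_prime.to_subtype
  -- `q ↦ ℚ(i√q) ⊆ E`
  let f : {q : ℕ // q.Prime} → IntermediateField ℚ ↥E := fun q => IntermediateField.adjoin ℚ {w q.1}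
  obtain ⟨q, q', hne, hfeq⟩ := Finite.exists_ne_map_eq_of_infinite f
  apply hne
  apply Subtype.ext
  -- `w q' ∈ ℚ(w q)` inside `E`, hence `w q' = a + b·w q` with `a, b ∈ ℚ`
  have hmem : w q'.1 ∈ (⊥ : IntermediateField ℚ ↥E) ⊔ IntermediateField.adjoin ℚ {w q.1} := by
    refine (le_sup_right : IntermediateField.adjoin ℚ {w q.1} ≤ _) ?_
    change w q'.1 ∈ f q
    rw [hfeq]
    exact IntermediateField.mem_adjoin_simple_self ℚ _
  have hsq : w q.1 * w q.1 ∈ (⊥ : IntermediateField ℚ ↥E) := by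
    have : w q.1 * w q.1 = -(q.1 : ↥E) := by
      apply Subtype.ext
      push_cast
      rw [hw q.1 q.2, twistRoot_mul_self]
    rw [this]
    exact neg_mem (IntermediateField.natCast_mem ⊥ q.1)
  obtain ⟨a, ha, b, hb, hab⟩ := exists_add_mul_of_mem_sup_adjoin ⊥ hsq hmem
  obtain ⟨a, rfl⟩ := IntermediateField.mem_bot.1 ha
  obtain ⟨b, rfl⟩ := IntermediateField.mem_bot.1 hb
  refine eq_of_twistRoot_eq_add_mul q.2 q'.2 (a := a) (b := b) ?_
  have key : ((w q'.1 : ↥E) : ℂ) = ((algebraMap ℚ ↥E a + algebraMap ℚ ↥E b * w q.1 : ↥E) : ℂ) :=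
    congrArg Subtype.val hab
  rw [hw q'.1 q'.2] at key
  rw [key, eq_ratCast, eq_ratCast]
  push_cast
  rw [hw q.1 q.2]

end Literature.NumberTheory.NumberFields

end
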